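import Summits.QuantumFields.YangMills.Theses.LangevinControlUV

/-!
# `OSLegsAtWeakCouplingC` — negative-side support III: the conclusion is a germ property of the
# unit map at `+∞`; continuity makes the tail lift a weak-coupling unit

Support file for crux `stmt-QuantumFields-16207`
(`Summit.QuantumFields.YangMills.Theses.LangevinControlUV.OSLegsAtWeakCouplingC`), extracted from the
standing disprover's work file `Cruxes/OSLegsAtWeakCouplingC/Disproof.lean` §5. Tree objects only; the
conclusion body of the crux is quoted verbatim (for two unit maps).

* `conclC_congr_above`: if `a' = a` on some `[βs, ∞)`, the conclusion of the C-crux for `a` implies the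
  conclusion for `a'` — THIS is where the new conjunct `sch.HasWeakCouplingLimit` is used: the scheme
  is eventually above `βs`, drop its first `K` steps (`IsYangMillsFor`, `HasLatticeMassGap`,
  `HasWeakCouplingLimit` are shift-stable). With the hypotheses-side transports of the predecessor
  (`twoPoint_congr_above`, `skewness_congr_above`, `gapInUnits_congr_above`,
  `Cruxes/OSLegsFromFemtoAndGap/Disproof.lean` §6) the crux instance at `(G, r, a)` depends on `a` only
  through its germ at `+∞` plus global positivity; in particular `Continuous a` may be weakened to
  continuity on a tail at no cost.
* `hasWeakCouplingLimit_of_units_tailLift`: for CONTINUOUS positive `a`, every scheme in units of the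
  tail lift `β ↦ a (max β βs) + max (βs − β) 0` runs to `β = +∞` (below `βs` the lift is `≥ a βs`,
  while `a_k → 0`; above, `a` is bounded below on compact windows).
* `conclC_of_concl_tailLift`: hence the OLD conclusion (no weak-coupling conjunct, stmt-9367's) along
  the tail lift gives the NEW conclusion along `a` — the step by which `OSLegsFromFemtoAndGap` implies
  `OSLegsAtWeakCouplingC` (the positive implication itself is recorded in the work file, §5b). [folklore]
-/

noncomputable section

open MeasureTheory Filter Topology
open Literature.MathematicalPhysics.AQFT Literature.MathematicalPhysics.QuantumLattice
open Literature.MathematicalPhysics.QuantumFieldTheory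

namespace Summit.QuantumFields.YangMills.Theorems.OSLegsAtWeakCouplingC.Negative

variable {G : Type} [Group G] [TopologicalSpace G] [IsTopologicalGroup G] [CompactSpace G]
  [MeasurableSpace G] [BorelSpace G]

/-- **The conclusion of `OSLegsAtWeakCouplingC` is a germ property of the unit map**: `a' = a` on
`[βs, ∞)` and the conclusion for `a` give the conclusion for `a'` (shift the weak-coupling scheme past
the threshold). No positivity or continuity of `a'` is needed. [folklore] -/
theorem conclC_congr_above (r : LatticeRep G) {a a' : ℝ → ℝ} (βs : ℝ)
    (heq : ∀ β, βs ≤ β → a' β = a β)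
    (h : ∃ (sch : SpeciesScheme (YMSpecies G)) (T : OSData (YMSpecies G) 4), (∀ k, sch.a k = a (sch.β k)) ∧ sch.HasWeakCouplingLimit ∧ IsYangMillsFor r sch T ∧ T.IsNontrivial r.curvature ∧ T.IsNonGaussian r.curvature ∧ ∃ Δ > 0, HasLatticeMassGap r sch Δ) :
    ∃ (sch : SpeciesScheme (YMSpecies G)) (T : OSData (YMSpecies G) 4), (∀ k, sch.a k = a' (sch.β k)) ∧ sch.HasWeakCouplingLimit ∧ IsYangMillsFor r sch T ∧ T.IsNontrivial r.curvature ∧ T.IsNonGaussian r.curvature ∧ ∃ Δ > 0, HasLatticeMassGap r sch Δ := by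
  obtain ⟨sch, T, hu, hw, hYM, hNT, hNG, Δ, hΔ, hgap⟩ := h
  obtain ⟨K, hK⟩ := eventually_atTop.1 (hw.eventually_ge_atTop βs)
  -- drop the first `K` steps
  let sch' : SpeciesScheme (YMSpecies G) :=
    { a := fun k => sch.a (k + K)
      a_pos := fun _ => sch.a_pos _
      tendsto_a := sch.tendsto_a.comp (tendsto_add_atTop_nat K)
      β := fun k => sch.β (k + K)
      L := fun k => sch.L (k + K)
      tendsto_L := sch.tendsto_L.comp (tendsto_add_atTop_nat K)
      c := fun s k => sch.c s (k + K)
      m := fun s k => sch.m s (k + K) }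
  refine ⟨sch', T, fun k => ?_, hw.comp (tendsto_add_atTop_nat K), ?_, hNT, hNG, Δ, hΔ, ?_⟩
  · show sch.a (k + K) = a' (sch.β (k + K))
    rw [hu, heq _ (hK _ (Nat.le_add_left K k))]
  · intro n hn σ f F hF hoff
    exact ((hYM n hn σ f F hF hoff).comp (tendsto_add_atTop_nat K)).congr'
      (Eventually.of_forall fun k => rfl)
  · intro A B
    obtain ⟨C, hC⟩ := hgap A B
    exact ⟨C, (tendsto_add_atTop_nat K).eventually hC⟩

section TailLift

variable {ι : Type}

/-- **Continuity makes the tail lift a weak-coupling unit.** For continuous positive `a` and any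
threshold `βs`, EVERY scheme in units `β ↦ a (max β βs) + max (βs − β) 0` is eventually above `βs`
and has `β_k → +∞`. [folklore] -/
theorem hasWeakCouplingLimit_of_units_tailLift {a : ℝ → ℝ} (ha : Continuous a) (hpos : ∀ β, 0 < a β)
    (βs : ℝ) (sch : SpeciesScheme ι)
    (hu : ∀ k, sch.a k = (fun β => a (max β βs) + max (βs - β) 0) (sch.β k)) :
    (∀ᶠ k in atTop, βs ≤ sch.β k) ∧ sch.HasWeakCouplingLimit := by
  -- eventually above the threshold: below it the lift is ≥ a βs > 0, while a_k → 0
  have hev : ∀ᶠ k in atTop, βs ≤ sch.β k := by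
    have h0 : ∀ᶠ k in atTop, sch.a k < a βs := sch.tendsto_a.eventually (gt_mem_nhds (hpos βs))
    filter_upwards [h0] with k hk
    by_contra hlt
    push Not at hlt
    have : a βs ≤ sch.a k := by
      rw [hu k]
      show a βs ≤ a (max (sch.β k) βs) + max (βs - sch.β k) 0
      rw [max_eq_right hlt.le]
      exact le_add_of_nonneg_right (le_max_right _ _)
    linarith
  refine ⟨hev, ?_⟩
  -- above the threshold the lift is `a`, bounded below on compact windows
  unfold SpeciesScheme.HasWeakCouplingLimit
  rw [tendsto_atTop]
  intro M
  obtain ⟨x₀, hx₀, hmin⟩ := (isCompact_Icc : IsCompact (Set.Icc βs (max M βs))).exists_isMinOn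
    ⟨βs, Set.left_mem_Icc.2 (le_max_right _ _)⟩ ha.continuousOn
  have hε : ∀ᶠ k in atTop, sch.a k < a x₀ := sch.tendsto_a.eventually (gt_mem_nhds (hpos x₀))
  filter_upwards [hev, hε] with k hk hka
  by_contra hlt
  push Not at hlt
  have hmem : sch.β k ∈ Set.Icc βs (max M βs) := ⟨hk, hlt.le.trans (le_max_left _ _)⟩
  have h1 := hmin hmem
  rw [Set.mem_setOf_eq] at h1
  have h2 : sch.a k = a (sch.β k) := by
    rw [hu k]
    show a (max (sch.β k) βs) + max (βs - sch.β k) 0 = a (sch.β k)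
    rw [max_eq_left hk, max_eq_right (by linarith), add_zero]
  linarith

end TailLift

/-- **The OLD conclusion (stmt-9367's, no weak-coupling conjunct) along the tail lift of a continuous
positive `a` gives the NEW conclusion along `a`.** [folklore] -/
theorem conclC_of_concl_tailLift (r : LatticeRep G) {a : ℝ → ℝ} (ha : Continuous a)
    (hpos : ∀ β, 0 < a β) (βs : ℝ)
    (h : ∃ (sch : SpeciesScheme (YMSpecies G)) (T : OSData (YMSpecies G) 4), (∀ k, sch.a k = (fun β => a (max β βs) + max (βs - β) 0) (sch.β k)) ∧ IsYangMillsFor r sch T ∧ T.IsNontrivial r.curvature ∧ T.IsNonGaussian r.curvature ∧ ∃ Δ > 0, HasLatticeMassGap r sch Δ) :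
    ∃ (sch : SpeciesScheme (YMSpecies G)) (T : OSData (YMSpecies G) 4), (∀ k, sch.a k = a (sch.β k)) ∧ sch.HasWeakCouplingLimit ∧ IsYangMillsFor r sch T ∧ T.IsNontrivial r.curvature ∧ T.IsNonGaussian r.curvature ∧ ∃ Δ > 0, HasLatticeMassGap r sch Δ := by
  obtain ⟨sch, T, hu, hYM, hNT, hNG, hgap⟩ := h
  have hw := (hasWeakCouplingLimit_of_units_tailLift ha hpos βs sch hu).2
  refine conclC_congr_above r (a := fun β => a (max β βs) + max (βs - β) 0) (a' := a) βs
    (fun β hβ => ?_) ⟨sch, T, hu, hw, hYM, hNT, hNG, hgap⟩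
  show a β = a (max β βs) + max (βs - β) 0
  rw [max_eq_left hβ, max_eq_right (by linarith), add_zero]

end Summit.QuantumFields.YangMills.Theorems.OSLegsAtWeakCouplingC.Negative

end
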